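import Summits.AnomalousDissipation.AnomalousDissipation.Theorems.LightSteadyStatesGP.Negative.TrivialWitnesses

/-!
# Stub `stub_lambModeTestGP` (S5) of line `Sketch` (crux stmt-AnomalousDissipation-15151,
  `VirtualDissipation.LightSteadyStatesGP`)

The LAMB-MODE TEST, for EVERY classical steady state `(u, p)` of `NS_ν(f_GP)` on `T³` (no symmetry,
any real `ν`): with `g = lambMode = (f_GP·∇)f_GP/(2π)` the six-mode field on the shell `|k|² = 2`,

  `∫⟪(u·∇)g, u⟫ = 8π²ν ∫⟪u, g⟫`.

Proof: test the steady momentum equation `(u·∇)u = νΔu − ∇p + f_GP` (the time derivative of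
time-constant data vanishes) against `g` and integrate over the torus:

* `∫⟪(u·∇)g, u⟫ = −∫⟪g, (u·∇)u⟫` — antisymmetry of the trilinear form for the solenoidal `u`
  (`Torus.integral_inner_convect_eq_neg`);
* `∫⟪g, Δu⟫ = ∫⟪u, Δg⟫ = −8π² ∫⟪u, g⟫` — Green's second identity
  (`Torus.integral_inner_laplacian_comm`) and `Δg = −8π² g` (`StubLambModeTest.laplacian_lambMode`:
  each of the six Stokes sine modes of `g` has `|k|² = 2`, `Torus.laplacian_stokesMode`, and the
  Laplacian is linear on smooth summands, `Torus.laplacian_finset_sum_smul`);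
* `∫⟪g, ∇p⟫ = 0` — `g` is smooth and solenoidal (`Torus.integral_inner_gradient_eq_zero_of_isDivFree`,
  admissibility of `g` from the landed `GPMeanBoundedFamily.stub_headModes`);
* `∫⟪g, f_GP⟫ = 0` — first shell against second shell (landed
  `LightSteadyStatesGP.Negative.TrivialWitnesses.integral_inner_gpForce_lambMode`).

Rearranged: `∫⟪(u·∇)g, u⟫ = −(ν·(−8π²)∫⟪u, g⟫ − 0 + 0) = 8π²ν ∫⟪u, g⟫`.
-/

noncomputable section

-- every `Summit.AnomalousDissipation.AnomalousDissipation.…` name repeats the summit = sub-problem segment (D-0017 layout)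
set_option linter.dupNamespace false

namespace Summit.AnomalousDissipation.AnomalousDissipation.Theorems.VirtualDissipation.LightSteadyStatesGP

open MeasureTheory Filter Topology UnitAddTorus
open scoped InnerProductSpace ENNReal
open Literature.Analysis.FunctionSpaces Literature.Analysis.FluidPDE
open Summit.AnomalousDissipation.AnomalousDissipation.Theorems.EnsembleRigidity

namespace StubLambModeTest

/-- `Δ g = −8π² g` for the Lamb mode `g = lambMode`: its six Stokes sine modes
(frequencies `e₁ ± e₂`, `±e₀ + e₂`, `e₀ ± e₁`) sit on the second shell `|k|² = 2`, where the Stokes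
eigenvalue is `4π²·2 = 8π²` (`Torus.laplacian_stokesMode`), and the Laplacian is linear on smooth
summands (`Torus.laplacian_finset_sum_smul`). [folklore] -/
theorem laplacian_lambMode (x : UnitAddTorus (Fin 3)) :
    Torus.laplacian lambMode x = (-(8 * Real.pi ^ 2)) • lambMode x := by
  -- adapted from `LightSteadyStatesGP.Negative.TrivialWitnesses.laplacian_gpForce` (first shell)
  have h : Torus.laplacian (fun y : UnitAddTorus (Fin 3) => ∑ j : Fin 6, (1 / 2 : ℝ) •
      (Torus.stokesMode (![![0, 1, 1], ![0, 1, -1], ![1, 0, 1], ![-1, 0, 1], ![1, 1, 0], ![1, -1, 0]] j)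
        (![EuclideanSpace.single 0 1, EuclideanSpace.single 0 1, EuclideanSpace.single 1 1,
            EuclideanSpace.single 1 1, EuclideanSpace.single 2 1, EuclideanSpace.single 2 1] j)
        false y : EuclideanSpace ℝ (Fin 3))) x =
      ∑ j : Fin 6, (1 / 2 : ℝ) • Torus.laplacian
        (⇑(Torus.stokesMode
          (![![0, 1, 1], ![0, 1, -1], ![1, 0, 1], ![-1, 0, 1], ![1, 1, 0], ![1, -1, 0]] j)
          (![EuclideanSpace.single 0 1, EuclideanSpace.single 0 1, EuclideanSpace.single 1 1,
              EuclideanSpace.single 1 1, EuclideanSpace.single 2 1, EuclideanSpace.single 2 1] j)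
          false)) x :=
    Literature.Analysis.FluidPDE.Torus.laplacian_finset_sum_smul Finset.univ (fun _ => (1 / 2 : ℝ))
      (fun j => Torus.isSmooth_stokesMode _ _ _) x
  rw [GPMeanBoundedFamily.StubHeadCoefficients.lambMode_eq_sum, h]
  simp only [Torus.laplacian_stokesMode, Finset.smul_sum, smul_smul]
  refine Finset.sum_congr rfl fun j _ => ?_
  congr 1
  fin_cases j <;>
    simp [Torus.stokesEigenvalue, Torus.freqNormSq, Fin.sum_univ_three, Matrix.cons_val] <;> ring

/-- The steady momentum equation of a classical solution with time-constant data, pointwise: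
`(u·∇)u = νΔu − ∇p + f_GP` (the one-sided time derivative of a constant-in-time field is `0`). [folklore] -/
theorem steady_momentum {ν : ℝ} {u : UnitAddTorus (Fin 3) → EuclideanSpace ℝ (Fin 3)}
    {p : UnitAddTorus (Fin 3) → ℝ}
    (h : Torus.IsClassicalNSSolutionOn Set.univ ν (fun _ => gpForce) (fun _ => u) (fun _ => p))
    (x : UnitAddTorus (Fin 3)) :
    Torus.convect u u x = ν • Torus.laplacian u x - Torus.gradient p x + gpForce x := by
  have h1 := h.momentum 0 (Set.mem_univ _) x
  have ht : Torus.timeDerivWithin Set.univ (fun _ : ℝ => u) 0 x = 0 := by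
    simp [Torus.timeDerivWithin]
  rw [ht, zero_add] at h1
  exact h1

end StubLambModeTest

/-- **S5 `stub_lambModeTestGP`** — the LAMB-MODE TEST, for EVERY classical steady state `(u, p)` of
`NS_ν(f_GP)` (no symmetry, any `ν`): `∫⟪(u·∇)g, u⟫ = 8π²ν ∫⟪u, g⟫` with `g = lambMode`. Test the
momentum equation `(u·∇)u = νΔu − ∇p + f_GP` with `g`: `∫⟪(u·∇)g, u⟫ = −∫⟪g, (u·∇)u⟫`
(`Torus.integral_inner_convect_eq_neg`), `∫⟪g, Δu⟫ = ∫⟪u, Δg⟫ = −8π²∫⟪u, g⟫` (`g` lives on the shell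
`|k|² = 2`), `∫⟪g, ∇p⟫ = 0` (`g` solenoidal), `∫⟪g, f_GP⟫ = 0` (landed
`Negative.TrivialWitnesses.integral_inner_gpForce_lambMode`). [folklore] -/
theorem stub_lambModeTestGP :
    ∀ (ν : ℝ) (u : UnitAddTorus (Fin 3) → EuclideanSpace ℝ (Fin 3)) (p : UnitAddTorus (Fin 3) → ℝ),
      Torus.IsClassicalNSSolutionOn Set.univ ν (fun _ => gpForce) (fun _ => u) (fun _ => p) →
      ∫ x, ⟪Torus.convect u lambMode x, u x⟫_ℝ = 8 * Real.pi ^ 2 * ν * ∫ x, ⟪u x, lambMode x⟫_ℝ := by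
  intro ν u p h
  have hu : Torus.IsSmooth u := h.smooth_velocity.isSmooth_slice (Set.mem_univ (0 : ℝ))
  have hp : Torus.IsSmooth p := h.smooth_pressure.isSmooth_slice (Set.mem_univ (0 : ℝ))
  have hud : Torus.IsDivFree u := h.divFree 0 (Set.mem_univ _)
  obtain ⟨⟨hgs, hgd, -⟩, -, -⟩ := GPMeanBoundedFamily.stub_headModes
  obtain ⟨hfs, -, -⟩ :
      Torus.IsSmooth gpForce ∧ Torus.IsDivFree gpForce ∧ Torus.HasZeroMean gpForce :=
    Summit.AnomalousDissipation.AnomalousDissipation.Theorems.SteadyStatesLoudBounded.GpAdmissible.stub_gpAdmissible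
  have hcomm : ∀ v w : UnitAddTorus (Fin 3) → EuclideanSpace ℝ (Fin 3),
      ∫ x, ⟪v x, w x⟫_ℝ = ∫ x, ⟪w x, v x⟫_ℝ :=
    fun v w => integral_congr_ae (ae_of_all _ fun x => real_inner_comm _ _)
  -- the three pairings of `g` with the right-hand side of the momentum equation
  have hLap : ∫ x, ⟪lambMode x, Torus.laplacian u x⟫_ℝ =
      -(8 * Real.pi ^ 2) * ∫ x, ⟪u x, lambMode x⟫_ℝ := by
    rw [hcomm lambMode (Torus.laplacian u), Torus.integral_inner_laplacian_comm hu hgs]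
    simp_rw [StubLambModeTest.laplacian_lambMode, real_inner_smul_right]
    exact integral_const_mul _ _
  have hP : ∫ x, ⟪lambMode x, Torus.gradient p x⟫_ℝ = 0 := by
    rw [hcomm lambMode (Torus.gradient p)]
    exact Torus.integral_inner_gradient_eq_zero_of_isDivFree hgs hp hgd
  have hF : ∫ x, ⟪lambMode x, gpForce x⟫_ℝ = 0 := by
    rw [hcomm lambMode gpForce]
    exact Summit.AnomalousDissipation.AnomalousDissipation.Theorems.LightSteadyStatesGP.Negative.TrivialWitnesses.integral_inner_gpForce_lambMode
  -- integrability of every term, from smoothness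
  have iL : Integrable (fun x => ⟪lambMode x, Torus.laplacian u x⟫_ℝ) volume :=
    (hgs.inner hu.laplacian).integrable
  have iP : Integrable (fun x => ⟪lambMode x, Torus.gradient p x⟫_ℝ) volume :=
    (hgs.inner hp.gradient).integrable
  have iF : Integrable (fun x => ⟪lambMode x, gpForce x⟫_ℝ) volume := (hgs.inner hfs).integrable
  have iLP : Integrable (fun x => ν * ⟪lambMode x, Torus.laplacian u x⟫_ℝ -
      ⟪lambMode x, Torus.gradient p x⟫_ℝ) volume := (iL.const_mul ν).sub iP
  -- antisymmetry of the trilinear form, then the tested momentum equation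
  rw [Torus.integral_inner_convect_eq_neg hu hud hgs hu]
  simp_rw [StubLambModeTest.steady_momentum h, inner_add_right, inner_sub_right,
    real_inner_smul_right]
  rw [integral_add iLP iF, integral_sub (iL.const_mul ν) iP, integral_const_mul, hLap, hP, hF]
  ring

end Summit.AnomalousDissipation.AnomalousDissipation.Theorems.VirtualDissipation.LightSteadyStatesGP

end
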